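import Literature.NumberTheory.Automorphic.KimExteriorSquareGL4Proofs
import Literature.NumberTheory.Automorphic.AutomorphicTwistHecke
import HarnessLib

/-!
# Kim's exterior square `GL₄ → GL₆`: the conclusion of Theorem A is invariant under twisting and
# under near-equivalence

Sibling proof file (theorems only; no `sorry`, no definition, no named fact) of
`Literature.NumberTheory.Automorphic.KimExteriorSquareGL4`, in support of the named fact
`Kim2003_exteriorSquare_GL4` (H. H. Kim, J. Amer. Math. Soc. **16** (2003), Thm. A p. 139 =
Thm. 4.2.3 p. 156 / Thm. 5.3.1 p. 165 [Kim2002]).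

Kim's standing convention (p. 139): *"In what follows, a cuspidal representation always means a
unitary one."* The tree's fact is stated for **every** cuspidal Borel–Jacquet datum `π` on
`GL₄(𝔸_F)`, on the strength of the reduction recorded in the module docstring of
`KimExteriorSquareGL4`: every cuspidal `π` is a twist `π₀ ⊗ |det|^s` (up to near-equivalence) of a
unitary cuspidal `π₀`, and `∧²(π₀ ⊗ χ) = ∧²π₀ ⊗ χ²`. This file proves the representation-level
form of that reduction — the two invariance properties of the *conclusion* of the fact for a
fixed `π`,

  `∃ P` automorphic on `GL₆(𝔸_F)` with (i) `t_{P,v} = ∧² t_{π,v}` a.e. and (ii) cuspidal `σᵢ` on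
  `GL_{nᵢ}`, `∑ nᵢ = 6`, with `t_{P,v} = ⊎ᵢ t_{σᵢ,v}` a.e.

(spelled out verbatim in each statement; no predicate is introduced):

* `AutomorphicRepData.eventually_hasSatakeParamAt_of_map_mulChar_detTwist_symm` — Satake parameters
  transfer *back* along a twist: if `π' = π ⊗ (χ ∘ det)` (`W' · c`, `W · c`, `c = χ ∘ det`, as
  produced by `exists_automorphicRepData_twist_hecke`) then a.e. `t_{π',v} = α ⇒ t_{π,v} = χ(ϖ_v)⁻¹ α`
  (the accepted forward rule `AutomorphicRepData.eventually_hasSatakeParamAt_of_map_mulChar_detTwist`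
  for `χ⁻¹`, since `(W · c) · c⁻¹ = W`; Arthur–Clozel 1989, Ch. 3, proof of Thm. 3.1, p. 172).
* `Kim2003_exteriorSquare_GL4.conclusion_of_twist` — **twist invariance**: if the conclusion holds
  for `π` then it holds for every twist `π₁ = π ⊗ (χ ∘ det)` by an idèle class character `χ`, with
  `P₁ = P ⊗ (χ² ∘ det)` and `σᵢ ⊗ (χ² ∘ det)` (`∧²(χ α) = χ² ∧²α`, `wedgeTwoParams_map_mul`;
  `⊎ᵢ χ² βᵢ = χ² ⊎ᵢ βᵢ`). With `χ = ‖·‖^s` this is Kim's normalisation step; with `χ` of finite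
  order it is the compatibility `∧²(π ⊗ χ) = ∧²π ⊗ χ²` used throughout §§4–5 (e.g. p. 143:
  `L(s, (σ ⊗ χ) × Π) = L(s, σ × (Π ⊗ χ))`).
* `Kim2003_exteriorSquare_GL4.conclusion_of_isNearlyEquivalent` — **rigidity**: the conclusion
  depends on `π` only through its near-equivalence class (`IsNearlyEquivalent`: same Satake
  parameters a.e.; Jacquet–Shalika 1981, §4), by the proved uniqueness of Satake parameters
  (`AutomorphicRepData.hasSatakeParamAt_unique_holds`, Flath 1979, Thm. 3).

Consequently the set of cuspidal data for which Theorem A holds in the tree's rendering is closed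
under twists and near-equivalence, so that a proof for unitary-normalised data (Kim's setting)
gives the fact as stated. Nothing here assumes the fact.

## References

* [Kim2002] H. H. Kim, J. Amer. Math. Soc. 16 (2003): p. 139 (convention), p. 143, Thm. 4.2.3.
* J. Arthur, L. Clozel, *Simple algebras, base change, and the advanced theory of the trace
  formula*, Ann. of Math. Stud. 120 (1989), Ch. 3, proof of Thm. 3.1 (p. 172) [ArthurClozelAMS120].
* A. Borel, H. Jacquet, Corvallis (1979), Part 1, §4.6, 5.7 [BorelJacquet1979].
* H. Jacquet, J. Shalika, *On Euler products and the classification of automorphic forms II*,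
  Amer. J. Math. 103 (1981), §4 [JacquetShalika1981].
-/

noncomputable section

open scoped MatrixGroups Classical NumberField
open NumberField IsDedekindDomain Filter
open Literature.NumberTheory.GaloisRepresentations (HeckeCharacter)

namespace Literature.NumberTheory.Automorphic

/-! ### Bookkeeping on multisets and values of Hecke characters -/

section Bookkeeping

/-- `(∑ᵢ βᵢ).map f = ∑ᵢ (βᵢ.map f)` (`Multiset.map` is additive). [folklore] -/
private theorem multiset_map_sum {ι : Type*} (s : Finset ι) (β : ι → Multiset ℂ) (f : ℂ → ℂ) :
    (∑ i ∈ s, β i).map f = ∑ i ∈ s, (β i).map f := by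
  simpa only [Multiset.coe_mapAddMonoidHom] using map_sum (Multiset.mapAddMonoidHom f) β s

/-- Scaling by `a` and then by `b` with `b a = 1` is the identity on multisets. [folklore] -/
private theorem map_mul_map_mul_of_mul_eq_one {a b : ℂ} (h : b * a = 1) (α : Multiset ℂ) :
    (α.map (a * ·)).map (b * ·) = α := by
  rw [Multiset.map_map, Function.comp_def]
  simp_rw [← mul_assoc, h, one_mul]
  exact Multiset.map_id' α

variable {K : Type} [Field K] [NumberField K]

/-- `(χ ψ)(ϖ_v) = χ(ϖ_v) ψ(ϖ_v)`. [folklore] -/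
private theorem valueAtUniformizer_mul' (χ ψ : HeckeCharacter K) (v : HeightOneSpectrum (𝓞 K)) :
    (χ * ψ).valueAtUniformizer v = χ.valueAtUniformizer v * ψ.valueAtUniformizer v := by
  simp only [GaloisRepresentations.HeckeCharacter.valueAtUniformizer,
    GaloisRepresentations.HeckeCharacter.localComponent_apply,
    GaloisRepresentations.HeckeCharacter.mul_apply, Units.val_mul]

/-- `χ⁻¹(ϖ_v) = χ(ϖ_v)⁻¹`. [folklore] -/
private theorem valueAtUniformizer_inv' (χ : HeckeCharacter K) (v : HeightOneSpectrum (𝓞 K)) :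
    χ⁻¹.valueAtUniformizer v = (χ.valueAtUniformizer v)⁻¹ := by
  simp only [GaloisRepresentations.HeckeCharacter.valueAtUniformizer,
    GaloisRepresentations.HeckeCharacter.localComponent_apply,
    GaloisRepresentations.HeckeCharacter.inv_apply, Units.val_inv_eq_inv_val]

/-- `χ(ϖ_v) ≠ 0` (a value of a character into `ℂˣ`). [folklore] -/
private theorem valueAtUniformizer_ne_zero' (χ : HeckeCharacter K) (v : HeightOneSpectrum (𝓞 K)) :
    χ.valueAtUniformizer v ≠ 0 :=
  Units.ne_zero _

end Bookkeeping

/-! ### Satake parameters transfer back along a twist -/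

section TwistBack

variable {n : ℕ} {K : Type} [Field K] [NumberField K] {hcpt : isCompact_glFiniteIntegralLevel n K}

/-- **Satake parameters transfer back along a twist by `χ ∘ det`.** If `π' = π ⊗ (χ ∘ det)` in the
Borel–Jacquet model (`π'.W = π.W · c`, `π'.W' = π.W' · c`, `c = χ ∘ det`), then for almost every
finite `v`: whenever `π'` has Satake parameter `α` at `v`, `π` has Satake parameter `χ(ϖ_v)⁻¹ · α`
at `v` — the forward rule (`AutomorphicRepData.eventually_hasSatakeParamAt_of_map_mulChar_detTwist`,
Arthur–Clozel 1989, Ch. 3, proof of Thm. 3.1: `t_{π ⊗ η, v} = η(ϖ_v) t_{π,v}`) applied to `χ⁻¹`,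
as `π = π' ⊗ (χ⁻¹ ∘ det)` on the nose (`(W · c) · c⁻¹ = W`).
[cite: ArthurClozelAMS120, Ch. 3, proof of Thm. 3.1 (p. 172)] -/
theorem AutomorphicRepData.eventually_hasSatakeParamAt_of_map_mulChar_detTwist_symm
    {π π' : AutomorphicRepData (AutomorphyDatum.gl n K hcpt)} (χ : HeckeCharacter K)
    (hW : π'.W = π.W.map (mulChar (detTwist n χ)))
    (hW' : π'.W' = π.W'.map (mulChar (detTwist n χ))) :
    ∀ᶠ v : HeightOneSpectrum (𝓞 K) in cofinite, ∀ α : Multiset ℂ,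
      π'.HasSatakeParamAt v α →
        π.HasSatakeParamAt v (α.map ((χ.valueAtUniformizer v)⁻¹ * ·)) := by
  have hWs : π.W = π'.W.map (mulChar (detTwist n χ⁻¹)) := by
    rw [hW, detTwist_inv, map_mulChar_inv_map_mulChar]
  have hW's : π.W' = π'.W'.map (mulChar (detTwist n χ⁻¹)) := by
    rw [hW', detTwist_inv, map_mulChar_inv_map_mulChar]
  filter_upwards [AutomorphicRepData.eventually_hasSatakeParamAt_of_map_mulChar_detTwist χ⁻¹ hWs hW's]
    with v hv α hα
  simpa only [valueAtUniformizer_inv'] using hv α hα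

end TwistBack

/-! ### Invariance of the conclusion of Theorem A -/

section Kim

variable (F : Type) [Field F] [NumberField F] (hF : ∀ m : ℕ, isCompact_glFiniteIntegralLevel m F)

/-- **Twist invariance of the conclusion of Kim's Theorem A** (Kim 2003, p. 139: "a cuspidal
representation always means a unitary one" — the general case being a twist; and p. 143:
`L(s, (σ ⊗ χ) × Π) = L(s, σ × (Π ⊗ χ))`). Let `χ` be an idèle class character of `F` and
`π₁ = π ⊗ (χ ∘ det)` a twist of the cuspidal datum `π` on `GL₄(𝔸_F)` (Borel–Jacquet model:
`π₁.W = π.W · (χ∘det)`, `π₁.W' = π.W' · (χ∘det)`, cf. `exists_cuspidalAutomorphicRepData_twist_hecke`).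
If the conclusion of `Kim2003_exteriorSquare_GL4` holds for `π` — an automorphic `P` on `GL₆(𝔸_F)`
with `t_{P,v} = ∧² t_{π,v}` a.e. and cuspidal `σᵢ` on `GL_{nᵢ}`, `∑ nᵢ = 6`, with
`t_{P,v} = ⊎ᵢ t_{σᵢ,v}` a.e. — then it holds for `π₁`, with `P ⊗ (χ² ∘ det)` and
`σᵢ ⊗ (χ² ∘ det)`: on Satake parameters `∧²(χ(ϖ_v) α) = χ(ϖ_v)² ∧²α` (`wedgeTwoParams_map_mul`)
and `⊎ᵢ χ(ϖ_v)² βᵢ = χ(ϖ_v)² ⊎ᵢ βᵢ`. [cite: Kim2002, §1 p. 139 (convention) and §2 p. 143] -/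
theorem Kim2003_exteriorSquare_GL4.conclusion_of_twist (χ : HeckeCharacter F)
    {π π₁ : CuspidalAutomorphicRepData 4 F (hF 4)}
    (hW : π₁.1.W = π.1.W.map (mulChar (detTwist 4 χ)))
    (hW' : π₁.1.W' = π.1.W'.map (mulChar (detTwist 4 χ)))
    (h : ∃ P : AutomorphicRepData (AutomorphyDatum.gl 6 F (hF 6)),
      (∀ᶠ v : HeightOneSpectrum (𝓞 F) in cofinite, ∀ α : Multiset ℂ,
        π.1.HasSatakeParamAt v α → P.HasSatakeParamAt v (wedgeTwoParams α)) ∧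
      ∃ (k : ℕ) (m : Fin k → ℕ) (σ : ∀ i : Fin k, CuspidalAutomorphicRepData (m i) F (hF (m i))),
        (∑ i, m i = 6) ∧
        ∀ᶠ v : HeightOneSpectrum (𝓞 F) in cofinite, ∀ β : Fin k → Multiset ℂ,
          (∀ i, (σ i).1.HasSatakeParamAt v (β i)) → P.HasSatakeParamAt v (∑ i, β i)) :
    ∃ P₁ : AutomorphicRepData (AutomorphyDatum.gl 6 F (hF 6)),
      (∀ᶠ v : HeightOneSpectrum (𝓞 F) in cofinite, ∀ α : Multiset ℂ,
        π₁.1.HasSatakeParamAt v α → P₁.HasSatakeParamAt v (wedgeTwoParams α)) ∧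
      ∃ (k : ℕ) (m : Fin k → ℕ) (σ : ∀ i : Fin k, CuspidalAutomorphicRepData (m i) F (hF (m i))),
        (∑ i, m i = 6) ∧
        ∀ᶠ v : HeightOneSpectrum (𝓞 F) in cofinite, ∀ β : Fin k → Multiset ℂ,
          (∀ i, (σ i).1.HasSatakeParamAt v (β i)) → P₁.HasSatakeParamAt v (∑ i, β i) := by
  obtain ⟨P, hP, k, m, σ, hm, hσ⟩ := h
  -- the twisted lift `P₁ = P ⊗ (χ² ∘ det)` and its Satake parameters
  obtain ⟨P₁, hPW, hPW'⟩ := exists_automorphicRepData_twist_hecke (χ * χ) P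
  have hP₁ := AutomorphicRepData.eventually_hasSatakeParamAt_of_map_mulChar_detTwist (χ * χ) hPW hPW'
  -- Satake parameters of `π₁` transfer back to `π`
  have hπ := AutomorphicRepData.eventually_hasSatakeParamAt_of_map_mulChar_detTwist_symm χ hW hW'
  -- the twisted cuspidal data `σᵢ ⊗ (χ² ∘ det)` (for `nᵢ = 0` there is nothing to twist)
  have key : ∀ i : Fin k, ∃ τ : CuspidalAutomorphicRepData (m i) F (hF (m i)),
      ∀ᶠ v : HeightOneSpectrum (𝓞 F) in cofinite, ∀ β : Multiset ℂ,
        τ.1.HasSatakeParamAt v β →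
          (σ i).1.HasSatakeParamAt v (β.map ((((χ * χ).valueAtUniformizer v)⁻¹) * ·)) := by
    intro i
    rcases Nat.eq_zero_or_pos (m i) with h0 | hpos
    · refine ⟨σ i, Filter.Eventually.of_forall fun v β hβ => ?_⟩
      have hβ0 : β = 0 := Multiset.card_eq_zero.mp (hβ.card_eq.trans h0)
      simpa only [hβ0, Multiset.map_zero] using hβ
    · haveI : NeZero (m i) := ⟨hpos.ne'⟩
      obtain ⟨τ, hτW, hτW'⟩ := exists_cuspidalAutomorphicRepData_twist_hecke (χ * χ) (σ i)
      exact ⟨τ, AutomorphicRepData.eventually_hasSatakeParamAt_of_map_mulChar_detTwist_symm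
        (χ * χ) hτW hτW'⟩
  choose τ hτ using key
  refine ⟨P₁, ?_, k, m, τ, hm, ?_⟩
  · -- clause (i): `∧²(χ α) = χ² ∧² α`
    filter_upwards [hπ, hP, hP₁] with v h1 h2 h3 α₁ hα₁
    have hc : χ.valueAtUniformizer v ≠ 0 := valueAtUniformizer_ne_zero' χ v
    have step := h3 _ (h2 _ (h1 α₁ hα₁))
    rw [wedgeTwoParams_map_mul, valueAtUniformizer_mul',
      map_mul_map_mul_of_mul_eq_one (by field_simp)] at step
    exact step
  · -- clause (ii): `⊎ᵢ χ² βᵢ = χ² ⊎ᵢ βᵢ`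
    filter_upwards [Filter.eventually_all.2 hτ, hσ, hP₁] with v H h2 h3 β hβ
    have hc : (χ * χ).valueAtUniformizer v ≠ 0 := valueAtUniformizer_ne_zero' (χ * χ) v
    have step := h3 _ (h2 (fun i => (β i).map ((((χ * χ).valueAtUniformizer v)⁻¹) * ·))
      fun i => H i (β i) (hβ i))
    rw [← multiset_map_sum, map_mul_map_mul_of_mul_eq_one (mul_inv_cancel₀ hc)] at step
    exact step

/-- **The conclusion of Kim's Theorem A depends on `π` only up to near-equivalence** (rigidity of
the rendering: `Kim2003_exteriorSquare_GL4` reads `π` only through its Satake parameters at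
almost all places; Jacquet–Shalika 1981, §4). If `π` and `π₁` are nearly equivalent cuspidal data
on `GL₄(𝔸_F)` (`IsNearlyEquivalent`: a common Satake parameter at almost every `v`) and the
conclusion of the fact holds for `π`, then it holds for `π₁` with the same `P` and the same `σᵢ`
— by the uniqueness of Satake parameters of `π₁` (`AutomorphicRepData.hasSatakeParamAt_unique_holds`,
Flath 1979, Thm. 3, proved in the tree). [cite: JacquetShalika1981, §4] -/
theorem Kim2003_exteriorSquare_GL4.conclusion_of_isNearlyEquivalent
    {π π₁ : CuspidalAutomorphicRepData 4 F (hF 4)}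
    (hne : AutomorphicRepData.IsNearlyEquivalent π.1 π₁.1)
    (h : ∃ P : AutomorphicRepData (AutomorphyDatum.gl 6 F (hF 6)),
      (∀ᶠ v : HeightOneSpectrum (𝓞 F) in cofinite, ∀ α : Multiset ℂ,
        π.1.HasSatakeParamAt v α → P.HasSatakeParamAt v (wedgeTwoParams α)) ∧
      ∃ (k : ℕ) (m : Fin k → ℕ) (σ : ∀ i : Fin k, CuspidalAutomorphicRepData (m i) F (hF (m i))),
        (∑ i, m i = 6) ∧
        ∀ᶠ v : HeightOneSpectrum (𝓞 F) in cofinite, ∀ β : Fin k → Multiset ℂ,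
          (∀ i, (σ i).1.HasSatakeParamAt v (β i)) → P.HasSatakeParamAt v (∑ i, β i)) :
    ∃ P₁ : AutomorphicRepData (AutomorphyDatum.gl 6 F (hF 6)),
      (∀ᶠ v : HeightOneSpectrum (𝓞 F) in cofinite, ∀ α : Multiset ℂ,
        π₁.1.HasSatakeParamAt v α → P₁.HasSatakeParamAt v (wedgeTwoParams α)) ∧
      ∃ (k : ℕ) (m : Fin k → ℕ) (σ : ∀ i : Fin k, CuspidalAutomorphicRepData (m i) F (hF (m i))),
        (∑ i, m i = 6) ∧
        ∀ᶠ v : HeightOneSpectrum (𝓞 F) in cofinite, ∀ β : Fin k → Multiset ℂ,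
          (∀ i, (σ i).1.HasSatakeParamAt v (β i)) → P₁.HasSatakeParamAt v (∑ i, β i) := by
  obtain ⟨P, hP, hrest⟩ := h
  refine ⟨P, ?_, hrest⟩
  filter_upwards [hne, hP] with v hv h1 α₁ hα₁
  obtain ⟨α₀, hα₀, hα₀'⟩ := hv
  have heq : α₁ = α₀ := AutomorphicRepData.hasSatakeParamAt_unique_holds π₁.1 hα₁ hα₀'
  rw [heq]
  exact h1 α₀ hα₀

/-- **The fact transfers along twists, globally**: if `Kim2003_exteriorSquare_GL4` is known for a
class of cuspidal data on `GL₄` containing, for every cuspidal `π`, some twist-and-near-equivalence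
representative — here phrased for one `π`: some `π ⊗ (χ ∘ det)` is nearly equivalent to a datum
`π₀` for which the conclusion holds — then it holds for `π`. This is the shape of Kim's reduction
to unitary cuspidal representations (p. 139), assembled from `conclusion_of_isNearlyEquivalent`
and `conclusion_of_twist` (twisting back by `χ⁻¹`: `(W · c) · c⁻¹ = W`).
[cite: Kim2002, §1 p. 139 (convention)] -/
theorem Kim2003_exteriorSquare_GL4.conclusion_of_twist_isNearlyEquivalent (χ : HeckeCharacter F)
    {π π₁ π₀ : CuspidalAutomorphicRepData 4 F (hF 4)}
    (hW : π₁.1.W = π.1.W.map (mulChar (detTwist 4 χ)))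
    (hW' : π₁.1.W' = π.1.W'.map (mulChar (detTwist 4 χ)))
    (hne : AutomorphicRepData.IsNearlyEquivalent π₀.1 π₁.1)
    (h : ∃ P : AutomorphicRepData (AutomorphyDatum.gl 6 F (hF 6)),
      (∀ᶠ v : HeightOneSpectrum (𝓞 F) in cofinite, ∀ α : Multiset ℂ,
        π₀.1.HasSatakeParamAt v α → P.HasSatakeParamAt v (wedgeTwoParams α)) ∧
      ∃ (k : ℕ) (m : Fin k → ℕ) (σ : ∀ i : Fin k, CuspidalAutomorphicRepData (m i) F (hF (m i))),
        (∑ i, m i = 6) ∧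
        ∀ᶠ v : HeightOneSpectrum (𝓞 F) in cofinite, ∀ β : Fin k → Multiset ℂ,
          (∀ i, (σ i).1.HasSatakeParamAt v (β i)) → P.HasSatakeParamAt v (∑ i, β i)) :
    ∃ P₁ : AutomorphicRepData (AutomorphyDatum.gl 6 F (hF 6)),
      (∀ᶠ v : HeightOneSpectrum (𝓞 F) in cofinite, ∀ α : Multiset ℂ,
        π.1.HasSatakeParamAt v α → P₁.HasSatakeParamAt v (wedgeTwoParams α)) ∧
      ∃ (k : ℕ) (m : Fin k → ℕ) (σ : ∀ i : Fin k, CuspidalAutomorphicRepData (m i) F (hF (m i))),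
        (∑ i, m i = 6) ∧
        ∀ᶠ v : HeightOneSpectrum (𝓞 F) in cofinite, ∀ β : Fin k → Multiset ℂ,
          (∀ i, (σ i).1.HasSatakeParamAt v (β i)) → P₁.HasSatakeParamAt v (∑ i, β i) := by
  -- from `π₀` to the nearly equivalent `π₁`, then back to `π = π₁ ⊗ (χ⁻¹ ∘ det)`
  have h₁ := Kim2003_exteriorSquare_GL4.conclusion_of_isNearlyEquivalent F hF hne h
  have hWs : π.1.W = π₁.1.W.map (mulChar (detTwist 4 χ⁻¹)) := by
    rw [hW, detTwist_inv, map_mulChar_inv_map_mulChar]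
  have hW's : π.1.W' = π₁.1.W'.map (mulChar (detTwist 4 χ⁻¹)) := by
    rw [hW', detTwist_inv, map_mulChar_inv_map_mulChar]
  exact Kim2003_exteriorSquare_GL4.conclusion_of_twist F hF χ⁻¹ hWs hW's h₁

end Kim

end Literature.NumberTheory.Automorphic

end
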